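import Mathlib
import Literature.Computability.AlgebraicComplexity.MatrixMultiplicationExponent
import Literature.Computability.AlgebraicComplexity.FlatteningBound

/-!
# Every natural format has an exponent threshold — stub `stub_exponentThreshold` of line
`registered` (birth skeleton `Cruxes/ShapeSubmodular/Lines/birth.lean`) of crux `ShapeSubmodular`
(stmt-MatrixMultiplication-15622, route `ShapeSubmodularity`)

For a natural format `(a, b, c) ∈ ℕ³` let `S(a,b,c) = {β ∈ ℝ | R⟨n^a, n^b, n^c⟩ = O(n^β)}` be its
admissible exponents in RANK FORM (`R = tensorRank`, `⟨·,·,·⟩ = matMulTensor ℂ`), the rectangular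
analogue of `admissibleExponents ℂ` (Bläser 2013, Def. 5.1).  The bookkeeping of Bläser 2013,
Def. 5.1 / Lemma 7.1:

* `S` is non-empty — the standard algorithm `R⟨k,m,n⟩ ≤ kmn` (`tensorRank_matMulTensor_le`) puts
  `a + b + c ∈ S` (`threshold_isBigO_standard`);
* `S` is bounded below by `0` — the flattening bound `km ≤ R⟨k,m,n⟩`
  (`mul_le_tensorRank_matMulTensor_left`) makes the ranks `≥ 1` from `n = 1` on
  (`threshold_one_le_tensorRank`), while `C · n^β → 0` for `β < 0`
  (`threshold_nonneg_of_isBigO_rpow`);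
* `S` is upward closed — `n^β ≤ n^γ` for `β ≤ γ` and `n ≥ 1` (`threshold_isBigO_rpow_of_le`).

Hence `m := inf S` (`= ω(a,b,c)`) is a THRESHOLD: every `β > m` is admissible
(`exists_lt_of_csInf_lt` and upward closure) and every admissible `β` is `≥ m` (`csInf_le`).  This is
the registered stub `stub_exponentThreshold`, consumed by the composition `submod_of_parts` of the
skeleton.  Imports only `MatrixMultiplicationExponent` and `FlatteningBound` (no `RectangularExponent*`
file enters the cone).
-/

set_option linter.dupNamespace false
-- (single-conjunct summit: the namespace repeats `MatrixMultiplication`)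

namespace Summit.MatrixMultiplication.MatrixMultiplication.Theorems.ShapeSubmodular

open Filter Asymptotics Literature.Computability.AlgebraicComplexity

/-- Upward closure of polynomial `O`-bounds along `ℕ`: `f = O(n^β)` and `β ≤ γ` give `f = O(n^γ)`,
since `n^β ≤ n^γ` for `n ≥ 1`. [folklore] -/
theorem threshold_isBigO_rpow_of_le {f : ℕ → ℝ} {β γ : ℝ}
    (hβ : f =O[atTop] fun n : ℕ => (n : ℝ) ^ β) (h : β ≤ γ) :
    f =O[atTop] fun n : ℕ => (n : ℝ) ^ γ := by
  refine hβ.trans (IsBigO.of_bound 1 ?_)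
  filter_upwards [eventually_ge_atTop 1] with n hn
  have hn' : (1 : ℝ) ≤ n := by exact_mod_cast hn
  rw [one_mul, Real.norm_of_nonneg (Real.rpow_nonneg (by positivity) _),
    Real.norm_of_nonneg (Real.rpow_nonneg (by positivity) _)]
  exact Real.rpow_le_rpow_of_exponent_le hn' h

/-- A sequence which is `≥ 1` from `n = 1` on is `O(n^β)` only for `β ≥ 0`
(`C · n^β → 0` for `β < 0`). [folklore] -/
theorem threshold_nonneg_of_isBigO_rpow {f : ℕ → ℝ} (hf : ∀ n : ℕ, 1 ≤ n → 1 ≤ f n) {β : ℝ}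
    (hβ : f =O[atTop] fun n : ℕ => (n : ℝ) ^ β) : 0 ≤ β := by
  by_contra hneg
  rw [not_le] at hneg
  obtain ⟨C, hC⟩ := isBigO_iff.1 hβ
  have hev : ∀ᶠ n : ℕ in atTop, (1 : ℝ) ≤ C * (n : ℝ) ^ β := by
    filter_upwards [hC, eventually_ge_atTop 1] with n hn hn1
    rw [Real.norm_of_nonneg (Real.rpow_nonneg (Nat.cast_nonneg _) _)] at hn
    exact ((hf n hn1).trans (Real.le_norm_self _)).trans hn
  have hlim : Tendsto (fun n : ℕ => C * (n : ℝ) ^ β) atTop (nhds (C * 0)) := by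
    refine Tendsto.const_mul C ?_
    have h1 : Tendsto (fun x : ℝ => x ^ β) atTop (nhds 0) := by
      have := tendsto_rpow_neg_atTop (by linarith : 0 < -β)
      simpa using this
    exact h1.comp tendsto_natCast_atTop_atTop
  rw [mul_zero] at hlim
  obtain ⟨n, hn1, hn2⟩ :=
    (hev.and (hlim.eventually (gt_mem_nhds (by norm_num : (0 : ℝ) < 1)))).exists
  linarith

/-- The rank of `⟨n^a, n^b, n^c⟩` is `≥ 1` for `n ≥ 1`: by flattening,
`n^a · n^b ≤ R⟨n^a, n^b, n^c⟩` (`mul_le_tensorRank_matMulTensor_left`, as `n^c ≥ 1`). [folklore] -/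
theorem threshold_one_le_tensorRank {n : ℕ} (hn : 1 ≤ n) (a b c : ℕ) :
    1 ≤ tensorRank (matMulTensor ℂ (n ^ a) (n ^ b) (n ^ c)) := by
  have hn0 : 0 < n := hn
  have ha : 0 < n ^ a := pow_pos hn0 a
  have hb : 0 < n ^ b := pow_pos hn0 b
  have hc : 0 < n ^ c := pow_pos hn0 c
  haveI : NeZero (n ^ c) := ⟨hc.ne'⟩
  calc 1 ≤ n ^ a * n ^ b := Nat.mul_pos ha hb
    _ ≤ tensorRank (matMulTensor ℂ (n ^ a) (n ^ b) (n ^ c)) :=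
        mul_le_tensorRank_matMulTensor_left ℂ (n ^ a) (n ^ b) (n ^ c)

/-- The standard algorithm in rank form along the natural format `(a,b,c)`:
`R⟨n^a, n^b, n^c⟩ ≤ n^a n^b n^c = n^{a+b+c}` (`tensorRank_matMulTensor_le`), so `a + b + c` is an
admissible exponent. [folklore] -/
theorem threshold_isBigO_standard (a b c : ℕ) :
    (fun n : ℕ => (tensorRank (matMulTensor ℂ (n ^ a) (n ^ b) (n ^ c)) : ℝ)) =O[atTop]
      fun n : ℕ => (n : ℝ) ^ ((a + b + c : ℕ) : ℝ) := by
  refine IsBigO.of_bound 1 (Eventually.of_forall fun n => ?_)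
  rw [one_mul, Real.norm_of_nonneg (Nat.cast_nonneg _),
    Real.norm_of_nonneg (Real.rpow_nonneg (Nat.cast_nonneg _) _), Real.rpow_natCast]
  have h := tensorRank_matMulTensor_le ℂ (n ^ a) (n ^ b) (n ^ c)
  calc (tensorRank (matMulTensor ℂ (n ^ a) (n ^ b) (n ^ c)) : ℝ)
      ≤ (n ^ a * n ^ b * n ^ c : ℕ) := by exact_mod_cast h
    _ = (n : ℝ) ^ (a + b + c) := by push_cast; ring

/-- **Every natural format has an exponent** (registered stub `stub_exponentThreshold` of line
`registered`, crux `ShapeSubmodular`): for `(a,b,c) ∈ ℕ³` there is a real threshold `m` — namely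
`m = inf {β | R⟨n^a,n^b,n^c⟩ = O(n^β)} = ω(a,b,c)` — such that every `β > m` is admissible for
`R⟨n^a,n^b,n^c⟩` and every admissible `β` is `≥ m`.  The admissible set is non-empty by the standard
algorithm (`threshold_isBigO_standard`), bounded below by `0` by flattening
(`threshold_one_le_tensorRank`, `threshold_nonneg_of_isBigO_rpow`) and upward closed
(`threshold_isBigO_rpow_of_le`); then `exists_lt_of_csInf_lt` and `csInf_le`.
[cite: Blaser2013, Def. 5.1 and Lemma 7.1 (2)] -/
theorem stub_exponentThreshold :
    ∀ a b c : ℕ, ∃ m : ℝ,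
      (∀ β : ℝ, m < β →
        (fun n : ℕ => (Literature.Computability.AlgebraicComplexity.tensorRank
          (Literature.Computability.AlgebraicComplexity.matMulTensor ℂ (n ^ a) (n ^ b) (n ^ c)) : ℝ))
            =O[Filter.atTop] (fun n : ℕ => (n : ℝ) ^ β)) ∧
      (∀ β : ℝ,
        (fun n : ℕ => (Literature.Computability.AlgebraicComplexity.tensorRank
          (Literature.Computability.AlgebraicComplexity.matMulTensor ℂ (n ^ a) (n ^ b) (n ^ c)) : ℝ))
            =O[Filter.atTop] (fun n : ℕ => (n : ℝ) ^ β) → m ≤ β) := by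
  intro a b c
  set S : Set ℝ := {β : ℝ |
    (fun n : ℕ => (tensorRank (matMulTensor ℂ (n ^ a) (n ^ b) (n ^ c)) : ℝ)) =O[atTop]
      fun n : ℕ => (n : ℝ) ^ β}
  have hne : S.Nonempty := ⟨_, threshold_isBigO_standard a b c⟩
  have hbdd : BddBelow S := ⟨0, fun β hβ => threshold_nonneg_of_isBigO_rpow
    (fun n hn => by exact_mod_cast threshold_one_le_tensorRank hn a b c) hβ⟩
  refine ⟨sInf S, fun β hβ => ?_, fun β hβ => csInf_le hbdd hβ⟩
  obtain ⟨γ, hγ, hγβ⟩ := exists_lt_of_csInf_lt hne hβ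
  exact threshold_isBigO_rpow_of_le hγ hγβ.le

end Summit.MatrixMultiplication.MatrixMultiplication.Theorems.ShapeSubmodular
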